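import Literature.Geometry.Riemannian.ChangGurskyYangConformal
import HarnessLib

/-!
# Conformal covariance of the frame Weyl tensor in every dimension `m ≥ 3`
# (`W_{ψ²g}(e/ψ)_{ijkl} = ψ⁻² W_g(e)_{ijkl}`)

Topic `Geometry/Riemannian`; everything is PROVED (no definition, no named fact). Support file for
the named fact `Literature.Geometry.Riemannian.liQingShi_pinching_five` (Li–Qing–Shi 2017,
Thm. 1.8 at bulk dimension `n = 5`, `LiQingShiPinching.lean`), whose printed proof
(arXiv:1410.6402, pp. 12–13, Step 1) starts from the decay of the Weyl tensor of a conformally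
compact Einstein metric at infinity — "since `|W|[g⁺_j](p) → 0` as `p → ∞` on each conformally
compact Einstein manifold, there exists a point `p_j` so that `τ_j = |W|[g⁺_j](p_j) = max |W|`" —
which is the conformal covariance of the Weyl tensor applied to the compactification
`ḡ = ρ² g⁺ ∈ C²(X̄)`: `|W[g⁺]|_{g⁺} = ρ² |W[ḡ]|_ḡ ≤ C ρ²` (Li–Qing–Shi 2017, Lemma 1.6 and its
proof on p. 6, after Chruściel–Delay–Lee–Skinner; Besse 1987, Thm. 1.159 (c): `W' = e^{2f} W`
for `g' = e^{2f} g`). The bulk there has dimension `5`; the tree had the frame-wise covariance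
only in dimension `4` (`PseudoRiemannianMetric.weylFrame_conformal_sq`,
`ChangGurskyYangConformal.lean`, through the `Fin 4` bookkeeping
`weylCombination_kulkarniNomizu_frameDelta`) and the law of the NORM `|W_{ψ²g}|² = ψ⁻⁴|W_g|²`
in dimension `≥ 3` on manifolds modelled on their model space (`weylNormSq_conformal_sq`,
`Lorentzian/WeylConformal.lean`). Here the frame-wise law is proved in every dimension, for
frames indexed by any finite type of cardinality `dim E ≥ 3` and any boundaryless model:

* `sum_kulkarniNomizu_frameDelta_contract_card` — the contraction of a Kulkarni–Nomizu product
  with the Kronecker symbol in dimension `m = |ι|`: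
  `Σ_a (h ⊙ δ)_{a b c a} = (tr h) δ_{bc} + (m − 2) h_{bc}`, and its full trace
  `Σ_b Σ_a (h ⊙ δ)_{a b b a} = (2m − 2) tr h` (`sum_sum_kulkarniNomizu_frameDelta_contract_card`);
* `weylCombination_kulkarniNomizu_frameDelta_card` — **the Weyl part of `h ⊙ δ` vanishes in
  every dimension `m ≥ 3`** (Besse 1987, 1.116–1.117: `h ⊙ g` lies in the Ricci/scalar summand
  of the curvature decomposition): the combination
  `K − (1/(m−2)) (c(K) ⊙̃ δ) + (tr c(K)/((m−1)(m−2))) (δδ − δδ)` of `weylFrame_apply` applied to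
  `K = h ⊙ δ` is identically zero;
* `IsOrthonormalFrame.sum_curvatureForm_eq_ricci_card`, `.sum_ricci_eq_scalarCurvature_card` —
  an orthonormal frame of cardinality `dim E` computes the Ricci contraction and the scalar
  curvature (O'Neill 1983, Lemma 3.52, Def. 3.53; the `Fin 4` versions are in
  `ChangGurskyYangProofs.lean`);
* `IsOrthonormalFrame.smul_conformal_sq` — if `g' = ψ² g` at `x` and `e'` is `g'_x`-orthonormal,
  then `ψ(x) • e'` is `g_x`-orthonormal;
* **`PseudoRiemannianMetric.weylFrame_conformal_sq_card`** — for smooth metrics `g`, `g' = ψ² g`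
  (`ψ > 0` smooth) with their Levi-Civita connections on a manifold with boundaryless model of
  dimension `dim E ≥ 3`, and a `g_x`-orthonormal frame `e : ι → T_x M`, `|ι| = dim E`:
  `W_{g'}(ψ(x)⁻¹ e)_{ijkl} = ψ(x)⁻² W_g(e)_{ijkl}` (Besse 1987, Thm. 1.159 (c)), from the manifold
  form of Besse 1.159 (b) (`curvatureForm_conformal`: `Rm' = ψ²(Rm − B ⊙ g)`) and the algebra
  above;
* **`PseudoRiemannianMetric.weylFrame_conformal_sq_card'`** — the same law read on a
  `g'_x`-orthonormal frame `e'`: `W_{g'}(e')_{ijkl} = ψ(x)⁻² W_g(ψ(x) e')_{ijkl}`, and the bound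
  it gives, `|W_g(ψ(x) e')_{ijkl}| = ψ(x)² |W_{g'}(e')_{ijkl}|`
  (`abs_weylFrame_smul_eq_of_conformal_sq`) — the shape consumed by the decay step: with
  `g = g⁺`, `ψ = ρ`, `g' = ḡ`, a bound `|W_ḡ| ≤ C` on `ḡ`-orthonormal frames gives
  `|W_{g⁺}| ≤ C ρ²` on `g⁺`-orthonormal frames;
* `PseudoRiemannianMetric.weylNormSqFrame_conformal_sq_card` — `Σ W_{g'}(e/ψ)² = ψ⁻⁴ Σ W_g(e)²`.

## References

* A. L. Besse, *Einstein Manifolds*, Springer 1987, 1.110, 1.116–1.117, Thm. 1.159 (b), (c).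
  [Besse1987]
* G. Li, J. Qing, Y. Shi, *Gap phenomena and curvature estimates for conformally compact Einstein
  manifolds*, Trans. Amer. Math. Soc. 369 (2017) 4385–4413 (arXiv:1410.6402): Lemma 1.6 (p. 4),
  its proof (p. 6), proof of Thm. 1.8, Step 1 (pp. 12–13). [LiQingShi2017]
* B. O'Neill, *Semi-Riemannian geometry*, Academic Press 1983, Ch. 3, Lemma 3.52, Def. 3.53.
  [ONeill1983]
-/

noncomputable section

open Bundle Finset Module Set Function
open scoped Manifold ContDiff Topology

namespace Literature.Geometry.Riemannian

/-! ### Frame algebra in dimension `m = |ι|` -/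

section FrameAlgebra

variable {ι : Type*} [Fintype ι] [DecidableEq ι]

/-- **Contraction of `h ⊙ δ`** in dimension `m = |ι|`:
`Σ_a (h ⊙ δ)_{a b c a} = (tr h) δ_{bc} + (m − 2) h_{bc}` (slot convention of `kulkarniNomizu`,
`(h ⊙ k)_{abcd} = h_{ad} k_{bc} + h_{bc} k_{ad} − h_{ac} k_{bd} − h_{bd} k_{ac}`). In dimension `4` this
is `sum_kulkarniNomizu_frameDelta_contract` of `ChangGurskyYangConformal.lean`.
[cite: Besse1987, 1.116] -/
theorem sum_kulkarniNomizu_frameDelta_contract_card (h : ι → ι → ℝ) (b c : ι) :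
    ∑ a, kulkarniNomizu h frameDelta a b c a =
      (∑ a, h a a) * frameDelta b c + ((Fintype.card ι : ℝ) - 2) * h b c := by
  have h1 : ∀ a, kulkarniNomizu h frameDelta a b c a =
      h a a * frameDelta b c + h b c - (if b = a then h a c else 0) - (if a = c then h b a else 0) := by
    intro a
    simp only [kulkarniNomizu, frameDelta, mul_ite, mul_one, mul_zero, if_true]
  simp only [h1, Finset.sum_sub_distrib, Finset.sum_add_distrib, Finset.sum_ite_eq,
    Finset.sum_ite_eq', Finset.mem_univ, if_true, Finset.sum_const, Finset.card_univ,
    nsmul_eq_mul, ← Finset.sum_mul]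
  ring

/-- **Full trace of `h ⊙ δ`** in dimension `m = |ι|`: `Σ_b Σ_a (h ⊙ δ)_{a b b a} = (2m − 2) tr h`.
[cite: Besse1987, 1.116] -/
theorem sum_sum_kulkarniNomizu_frameDelta_contract_card (h : ι → ι → ℝ) :
    ∑ b, ∑ a, kulkarniNomizu h frameDelta a b b a =
      (2 * (Fintype.card ι : ℝ) - 2) * ∑ a, h a a := by
  simp only [sum_kulkarniNomizu_frameDelta_contract_card, frameDelta_self, mul_one,
    Finset.sum_add_distrib, Finset.sum_const, Finset.card_univ, nsmul_eq_mul, ← Finset.mul_sum]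
  ring

/-- **The Weyl part of `h ⊙ δ` vanishes in every dimension `m = |ι| ≥ 3`** (Besse 1987,
1.116–1.117: in the decomposition `R = (s/(2m(m−1))) g ⊙ g + (1/(m−2)) z ⊙ g + W` the products
`h ⊙ g` have no Weyl component): the combination of `weylFrame_apply` — curvature array minus
`1/(m−2)` times the Kulkarni–Nomizu-type Ricci correction plus `S/((m−1)(m−2))` times the scalar
correction — applied to the array `K = h ⊙ δ`, whose contractions are
`c(K)_{bc} = (tr h) δ_{bc} + (m−2) h_{bc}` and `tr c(K) = (2m−2) tr h`, is identically zero. The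
algebraic reason for the conformal invariance of the Weyl tensor. [cite: Besse1987, 1.116–1.117] -/
theorem weylCombination_kulkarniNomizu_frameDelta_card (h : ι → ι → ℝ) (hι : 3 ≤ Fintype.card ι)
    (i j k l : ι) :
    kulkarniNomizu h frameDelta i j k l -
        1 / ((Fintype.card ι : ℝ) - 2) *
          ((∑ a, kulkarniNomizu h frameDelta a i l a) * (if j = k then 1 else 0) +
            (∑ a, kulkarniNomizu h frameDelta a j k a) * (if i = l then 1 else 0) -
            (∑ a, kulkarniNomizu h frameDelta a i k a) * (if j = l then 1 else 0) -
            (∑ a, kulkarniNomizu h frameDelta a j l a) * (if i = k then 1 else 0)) +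
        (∑ b, ∑ a, kulkarniNomizu h frameDelta a b b a) /
            (((Fintype.card ι : ℝ) - 1) * ((Fintype.card ι : ℝ) - 2)) *
          ((if i = l then 1 else 0) * (if j = k then 1 else 0) -
            (if i = k then 1 else 0) * (if j = l then 1 else 0)) = 0 := by
  have h3 : (3 : ℝ) ≤ Fintype.card ι := by exact_mod_cast hι
  have hm2 : (Fintype.card ι : ℝ) - 2 ≠ 0 := by linarith
  have hm1 : (Fintype.card ι : ℝ) - 1 ≠ 0 := by linarith
  rw [sum_sum_kulkarniNomizu_frameDelta_contract_card]
  simp only [sum_kulkarniNomizu_frameDelta_contract_card]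
  simp only [kulkarniNomizu, frameDelta]
  field_simp
  ring

end FrameAlgebra

/-! ### Orthonormal frames of cardinality `dim E` compute `Ric` and `S` -/

section Frames

open Literature.Geometry.Lorentzian (PseudoRiemannianMetric)
open Literature.Geometry.Lorentzian.PseudoRiemannianMetric

variable {E : Type*} [NormedAddCommGroup E] [NormedSpace ℝ E] {H : Type*} [TopologicalSpace H]
  {I : ModelWithCorners ℝ E H} {M : Type*} [TopologicalSpace M] [ChartedSpace H M]
  [IsManifold I ∞ M] {n : ℕ∞ω} [FiniteDimensional ℝ E]
  (g : PseudoRiemannianMetric I n E (TangentSpace I : M → Type _)) [g.HasLeviCivita]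

/-- In an orthonormal frame of cardinality `dim E` the frame computes the Ricci contraction:
`Σ_a Rm(e_a, e_b, e_c, e_a) = Ric(e_b, e_c)` (O'Neill 1983, Lemma 3.52, via
`ricci_eq_sum_of_isOrthonormalFrame`; the `Fin 4` case is
`IsOrthonormalFrame.sum_curvatureForm_eq_ricci`). [cite: ONeill1983, Ch. 3, Lemma 3.52] -/
theorem _root_.Literature.Geometry.Lorentzian.PseudoRiemannianMetric.IsOrthonormalFrame.sum_curvatureForm_eq_ricci_card
    {x : M} {ι : Type*} [Fintype ι] {e : ι → TangentSpace I x} (he : g.IsOrthonormalFrame x e)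
    (hι : Fintype.card ι = finrank ℝ E) (b c : ι) :
    ∑ a, g.curvatureForm g.leviCivita x (e a) (e b) (e c) (e a) = g.ricci x (e b) (e c) := by
  have h := g.ricci_eq_sum_of_isOrthonormalFrame (he.toBasis hι)
    (by rw [he.coe_toBasis hι]; exact he) g.leviCivita (e b) (e c)
  rw [he.coe_toBasis hι] at h
  exact h.symm

/-- In an orthonormal frame of cardinality `dim E` the frame computes the scalar curvature:
`Σ_a Ric(e_a, e_a) = S` (O'Neill 1983, Def. 3.53, via `trace_eq_sum_of_isOrthonormalFrame`; the
`Fin 4` case is `IsOrthonormalFrame.sum_ricci_eq_scalarCurvature`). [cite: ONeill1983, Ch. 3, Def. 3.53] -/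
theorem _root_.Literature.Geometry.Lorentzian.PseudoRiemannianMetric.IsOrthonormalFrame.sum_ricci_eq_scalarCurvature_card
    {x : M} {ι : Type*} [Fintype ι] {e : ι → TangentSpace I x} (he : g.IsOrthonormalFrame x e)
    (hι : Fintype.card ι = finrank ℝ E) :
    ∑ a, g.ricci x (e a) (e a) = g.scalarCurvature x := by
  have h := g.trace_eq_sum_of_isOrthonormalFrame (he.toBasis hι)
    (by rw [he.coe_toBasis hι]; exact he) (g.ricci x)
  rw [he.coe_toBasis hι] at h
  exact h.symm

omit [FiniteDimensional ℝ E] [g.HasLeviCivita] in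
/-- If `g' = ψ² g` at `x` (`ψ(x) ≠ 0`) and `e'` is `g'_x`-orthonormal, then the rescaled frame
`ψ(x) • e'` is `g_x`-orthonormal (`g(ψe'ᵢ, ψe'ⱼ) = ψ² g(e'ᵢ, e'ⱼ) = g'(e'ᵢ, e'ⱼ)`). [folklore] -/
theorem _root_.Literature.Geometry.Lorentzian.PseudoRiemannianMetric.IsOrthonormalFrame.smul_conformal_sq
    (g' : PseudoRiemannianMetric I n E (TangentSpace I : M → Type _))
    {x : M} {ι : Type*} {e' : ι → TangentSpace I x} (he' : g'.IsOrthonormalFrame x e') {a : ℝ}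
    (hgg' : ∀ v w : TangentSpace I x, g'.val x v w = a ^ 2 * g.val x v w) :
    g.IsOrthonormalFrame x (fun i ↦ a • e' i) := by
  refine ⟨fun i ↦ ?_, fun i j hij ↦ ?_⟩
  · have h1 := he'.1 i
    rw [hgg'] at h1
    simp only [map_smul, _root_.smul_apply, smul_eq_mul]
    linear_combination h1
  · have h0 := he'.2 i j hij
    rw [hgg'] at h0
    simp only [map_smul, _root_.smul_apply, smul_eq_mul]
    linear_combination h0

end Frames

/-! ### Conformal covariance of the frame Weyl tensor in dimension `dim E ≥ 3` -/

section ConformalWeyl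

open Literature.Geometry.Lorentzian (PseudoRiemannianMetric)
open Literature.Geometry.Lorentzian.PseudoRiemannianMetric
open Literature.Geometry.Lorentzian

variable {E : Type*} [NormedAddCommGroup E] [NormedSpace ℝ E] [FiniteDimensional ℝ E]
  [CompleteSpace E] {H : Type*} [TopologicalSpace H] {I : ModelWithCorners ℝ E H} [I.Boundaryless]
  {M : Type*} [TopologicalSpace M] [ChartedSpace H M] [IsManifold I ∞ M]
  (g g' : PseudoRiemannianMetric I ∞ E (TangentSpace I : M → Type _))
  [g.HasLeviCivita] [g'.HasLeviCivita]

/-- **Conformal covariance of the Weyl tensor in every dimension `dim E ≥ 3`** (Besse 1987,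
Thm. 1.159 (c): `W' = e^{2f} W` as `(0,4)`-tensors for `g' = e^{2f} g`; `W' = W` as
`(1,3)`-tensors): for smooth metrics `g`, `g' = ψ² g` (`ψ > 0` smooth) with their Levi-Civita
connections and a `g_x`-orthonormal frame `e : ι → T_x M` with `|ι| = dim E ≥ 3`, the frame
`ψ(x)⁻¹ e` is `g'_x`-orthonormal and `W_{g'}(ψ(x)⁻¹ e)_{ijkl} = ψ(x)⁻² W_g(e)_{ijkl}`. Proof: the
manifold form of Besse 1.159 (b), `Rm' = ψ²(Rm − B ⊙ g)` (`curvatureForm_conformal`), the frame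
contractions `Ric = Σ Rm`, `S = Σ Ric` for both metrics, and
`weylCombination_kulkarniNomizu_frameDelta_card` (the Weyl part of `B ⊙ g` vanishes). The
dimension-four case is `weylFrame_conformal_sq` (`ChangGurskyYangConformal.lean`).
[cite: Besse1987, Thm. 1.159 (c)] -/
theorem _root_.Literature.Geometry.Lorentzian.PseudoRiemannianMetric.weylFrame_conformal_sq_card
    (h3 : 3 ≤ finrank ℝ E) {ι : Type*} [Fintype ι] [DecidableEq ι]
    (hι : Fintype.card ι = finrank ℝ E) {ψ : M → ℝ} (hψ : ContMDiff I 𝓘(ℝ) ∞ ψ)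
    (hpos : ∀ x, 0 < ψ x)
    (hgg' : ∀ (x : M) (v w : TangentSpace I x), g'.val x v w = ψ x ^ 2 * g.val x v w)
    {x : M} {e : ι → TangentSpace I x} (he : g.IsOrthonormalFrame x e) (i j k l : ι) :
    g'.weylFrame x (fun a ↦ (ψ x)⁻¹ • e a) i j k l = (ψ x)⁻¹ ^ 2 * g.weylFrame x e i j k l := by
  obtain ⟨B, hB⟩ := g.curvatureForm_conformal g' (φ := fun y ↦ ψ y ^ 2) (hψ.pow 2)
    (fun y ↦ pow_pos (hpos y) 2) hgg' x
  have hψ0 : ψ x ≠ 0 := (hpos x).ne'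
  have hι3 : 3 ≤ Fintype.card ι := by rw [hι]; exact h3
  set t : ℝ := (ψ x)⁻¹ with ht
  have htψ : t * ψ x = 1 := inv_mul_cancel₀ hψ0
  -- the rescaled frame is `g'`-orthonormal
  have he' : g'.IsOrthonormalFrame x (fun a ↦ t • e a) := he.conformal_sq g g' hψ0 (hgg' x)
  -- scaling of `Rm'` on the rescaled frame
  have hscale : ∀ m a b n, g'.curvatureForm g'.leviCivita x (t • e m) (t • e a) (t • e b) (t • e n) =
      t ^ 4 * g'.curvatureForm g'.leviCivita x (e m) (e a) (e b) (e n) := by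
    intro m a b n
    simp only [curvatureForm, map_smul, _root_.smul_apply, smul_eq_mul]
    ring
  -- the conformal formula on the frame `e`
  have hconf : ∀ m a b n, g'.curvatureForm g'.leviCivita x (e m) (e a) (e b) (e n) =
      ψ x ^ 2 * (g.curvatureForm g.leviCivita x (e m) (e a) (e b) (e n)
        - kulkarniNomizu (fun a b ↦ B (e a) (e b)) frameDelta m a b n) := by
    intro m a b n
    rw [hB]
    simp only [kulkarniNomizu, he.val_eq_ite, frameDelta]
  -- together: `Rm'` on the rescaled frame through `Rm` and `B ⊙ δ` on `e`
  have hboth : ∀ m a b n, g'.curvatureForm g'.leviCivita x (t • e m) (t • e a) (t • e b) (t • e n) =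
      t ^ 2 * (g.curvatureForm g.leviCivita x (e m) (e a) (e b) (e n)
        - kulkarniNomizu (fun a b ↦ B (e a) (e b)) frameDelta m a b n) := by
    intro m a b n
    have ht4 : t ^ 4 * ψ x ^ 2 = t ^ 2 := by
      rw [show t ^ 4 * ψ x ^ 2 = t ^ 2 * (t * ψ x) ^ 2 by ring, htψ, one_pow, mul_one]
    rw [hscale, hconf, ← mul_assoc, ht4]
  -- Ricci and scalar curvature of both metrics through the frames
  rw [weylFrame_apply, weylFrame_apply,
    ← he'.sum_curvatureForm_eq_ricci_card g' hι, ← he'.sum_curvatureForm_eq_ricci_card g' hι,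
    ← he'.sum_curvatureForm_eq_ricci_card g' hι, ← he'.sum_curvatureForm_eq_ricci_card g' hι,
    ← he'.sum_ricci_eq_scalarCurvature_card g' hι,
    ← he.sum_curvatureForm_eq_ricci_card g hι, ← he.sum_curvatureForm_eq_ricci_card g hι,
    ← he.sum_curvatureForm_eq_ricci_card g hι, ← he.sum_curvatureForm_eq_ricci_card g hι,
    ← he.sum_ricci_eq_scalarCurvature_card g hι]
  simp_rw [← he'.sum_curvatureForm_eq_ricci_card g' hι, ← he.sum_curvatureForm_eq_ricci_card g hι,
    hboth]
  have hW := weylCombination_kulkarniNomizu_frameDelta_card (fun a b ↦ B (e a) (e b)) hι3 i j k l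
  simp only [mul_sub, Finset.sum_sub_distrib, ← Finset.mul_sum]
  linear_combination (-(t ^ 2)) * hW

/-- **Conformal covariance of the Weyl tensor, read on a `g'`-orthonormal frame** (`g' = ψ² g`,
`dim E ≥ 3`): for a `g'_x`-orthonormal `e' : ι → T_x M` with `|ι| = dim E`, the frame `ψ(x) e'` is
`g_x`-orthonormal and `W_{g'}(e')_{ijkl} = ψ(x)⁻² W_g(ψ(x) e')_{ijkl}`. [cite: Besse1987, Thm. 1.159 (c)] -/
theorem _root_.Literature.Geometry.Lorentzian.PseudoRiemannianMetric.weylFrame_conformal_sq_card'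
    (h3 : 3 ≤ finrank ℝ E) {ι : Type*} [Fintype ι] [DecidableEq ι]
    (hι : Fintype.card ι = finrank ℝ E) {ψ : M → ℝ} (hψ : ContMDiff I 𝓘(ℝ) ∞ ψ)
    (hpos : ∀ x, 0 < ψ x)
    (hgg' : ∀ (x : M) (v w : TangentSpace I x), g'.val x v w = ψ x ^ 2 * g.val x v w)
    {x : M} {e' : ι → TangentSpace I x} (he' : g'.IsOrthonormalFrame x e') (i j k l : ι) :
    g'.weylFrame x e' i j k l = (ψ x)⁻¹ ^ 2 * g.weylFrame x (fun a ↦ ψ x • e' a) i j k l := by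
  have hψ0 : ψ x ≠ 0 := (hpos x).ne'
  have he : g.IsOrthonormalFrame x (fun a ↦ ψ x • e' a) := he'.smul_conformal_sq g g' (hgg' x)
  have h := g.weylFrame_conformal_sq_card g' h3 hι hψ hpos hgg' he i j k l
  have hframe : (fun a ↦ (ψ x)⁻¹ • (fun a ↦ ψ x • e' a) a) = e' := by
    funext a
    simp only [smul_smul, inv_mul_cancel₀ hψ0, one_smul]
  rw [hframe] at h
  exact h

/-- **The decay shape**: for `g' = ψ² g` (`dim E ≥ 3`) and a `g'_x`-orthonormal frame `e'` with
`|ι| = dim E`, `|W_g(ψ(x) e')_{ijkl}| = ψ(x)² |W_{g'}(e')_{ijkl}|` — with `g = g⁺` a conformally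
compact metric, `g' = ḡ = ρ² g⁺` its compactification and `ψ = ρ`, a uniform bound `|W_ḡ| ≤ C` on
`ḡ`-orthonormal frames becomes `|W_{g⁺}| ≤ C ρ²` on `g⁺`-orthonormal frames, i.e. the Weyl tensor
of `g⁺` decays at infinity (Li–Qing–Shi 2017, proof of Thm. 1.8, Step 1, pp. 12–13, with
Lemma 1.6). [cite: LiQingShi2017, Thm. 1.8 (proof, Step 1, pp. 12–13)] [cite: Besse1987, Thm. 1.159 (c)] -/
theorem _root_.Literature.Geometry.Lorentzian.PseudoRiemannianMetric.abs_weylFrame_smul_eq_of_conformal_sq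
    (h3 : 3 ≤ finrank ℝ E) {ι : Type*} [Fintype ι] [DecidableEq ι]
    (hι : Fintype.card ι = finrank ℝ E) {ψ : M → ℝ} (hψ : ContMDiff I 𝓘(ℝ) ∞ ψ)
    (hpos : ∀ x, 0 < ψ x)
    (hgg' : ∀ (x : M) (v w : TangentSpace I x), g'.val x v w = ψ x ^ 2 * g.val x v w)
    {x : M} {e' : ι → TangentSpace I x} (he' : g'.IsOrthonormalFrame x e') (i j k l : ι) :
    |g.weylFrame x (fun a ↦ ψ x • e' a) i j k l| = ψ x ^ 2 * |g'.weylFrame x e' i j k l| := by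
  have hψ0 : ψ x ≠ 0 := (hpos x).ne'
  rw [g.weylFrame_conformal_sq_card' g' h3 hι hψ hpos hgg' he' i j k l, abs_mul, abs_pow,
    abs_inv, ← mul_assoc]
  have h1 : ψ x ^ 2 * |ψ x|⁻¹ ^ 2 = 1 := by
    rw [inv_pow, sq_abs, mul_inv_cancel₀ (pow_ne_zero 2 hψ0)]
  rw [h1, one_mul]

/-- **A uniform frame-wise Weyl bound for `g' = ψ² g` gives the decay bound `C ψ²` for `g`**:
if `|W_{g'}(e')_{ijkl}| ≤ C` for every `g'_x`-orthonormal frame `e'` of cardinality `dim E` at `x`,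
then `|W_g(e)_{ijkl}| ≤ C ψ(x)²` for every `g_x`-orthonormal frame `e` of that cardinality
(apply the previous identity to `e' = ψ(x)⁻¹ e`). This is how "`|W|[g⁺](p) → 0` as `p → ∞`" is
obtained from the `C²` compactification `ḡ = ρ² g⁺` in the proof of Li–Qing–Shi's Thm. 1.8.
[cite: LiQingShi2017, Thm. 1.8 (proof, Step 1, pp. 12–13)] -/
theorem _root_.Literature.Geometry.Lorentzian.PseudoRiemannianMetric.abs_weylFrame_le_mul_sq_of_conformal_sq
    (h3 : 3 ≤ finrank ℝ E) {ι : Type*} [Fintype ι] [DecidableEq ι]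
    (hι : Fintype.card ι = finrank ℝ E) {ψ : M → ℝ} (hψ : ContMDiff I 𝓘(ℝ) ∞ ψ)
    (hpos : ∀ x, 0 < ψ x)
    (hgg' : ∀ (x : M) (v w : TangentSpace I x), g'.val x v w = ψ x ^ 2 * g.val x v w)
    {x : M} {C : ℝ}
    (hC : ∀ e' : ι → TangentSpace I x, g'.IsOrthonormalFrame x e' →
      ∀ i j k l, |g'.weylFrame x e' i j k l| ≤ C)
    {e : ι → TangentSpace I x} (he : g.IsOrthonormalFrame x e) (i j k l : ι) :
    |g.weylFrame x e i j k l| ≤ C * ψ x ^ 2 := by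
  have hψ0 : ψ x ≠ 0 := (hpos x).ne'
  have he' : g'.IsOrthonormalFrame x (fun a ↦ (ψ x)⁻¹ • e a) := he.conformal_sq g g' hψ0 (hgg' x)
  have h := g.abs_weylFrame_smul_eq_of_conformal_sq g' h3 hι hψ hpos hgg' he' i j k l
  have hframe : (fun a ↦ ψ x • (fun a ↦ (ψ x)⁻¹ • e a) a) = e := by
    funext a
    simp only [smul_smul, mul_inv_cancel₀ hψ0, one_smul]
  rw [hframe] at h
  rw [h, mul_comm]
  exact mul_le_mul_of_nonneg_right (hC _ he' i j k l) (sq_nonneg _)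

/-- **`Σ W_{g'}(e/ψ)² = ψ⁻⁴ Σ W_g(e)²`** for the frame norms (`weylNormSqFrame`), `g' = ψ² g`,
`dim E ≥ 3`, `e` a `g_x`-orthonormal frame of cardinality `dim E`. [cite: Besse1987, Thm. 1.159 (c)] -/
theorem _root_.Literature.Geometry.Lorentzian.PseudoRiemannianMetric.weylNormSqFrame_conformal_sq_card
    (h3 : 3 ≤ finrank ℝ E) {ι : Type*} [Fintype ι] [DecidableEq ι]
    (hι : Fintype.card ι = finrank ℝ E) {ψ : M → ℝ} (hψ : ContMDiff I 𝓘(ℝ) ∞ ψ)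
    (hpos : ∀ x, 0 < ψ x)
    (hgg' : ∀ (x : M) (v w : TangentSpace I x), g'.val x v w = ψ x ^ 2 * g.val x v w)
    {x : M} {e : ι → TangentSpace I x} (he : g.IsOrthonormalFrame x e) :
    g'.weylNormSqFrame x (fun a ↦ (ψ x)⁻¹ • e a) = (ψ x)⁻¹ ^ 4 * g.weylNormSqFrame x e := by
  simp only [weylNormSqFrame, g.weylFrame_conformal_sq_card g' h3 hι hψ hpos hgg' he, mul_pow,
    ← Finset.mul_sum]
  ring

end ConformalWeyl

end Literature.Geometry.Riemannian
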